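import Literature.NumberTheory.PAdicHodge.TateAlmostEtaleTwistedBasis
import HarnessLib

/-!
# Étale steps: the almost-perfectoid package along extensions with a unit different
# (toward Tate's almost étale lemma — the prime-to-`p` part, Tate 1967 §3.2 Prop. 9 / Berger–Colmez (TS1))

Notation of `TateAlmostEtaleIntegralBases` / `TateAlmostEtaleTwistedBasis` (`K₀ ⊆ M ⊆ L ⊆ F̄`, `q = ‖p‖`,
package `pkg_s` = (Γ) + (U_s)). The Kummer route to (TS1) leaves, after the `p`-primary dévissage
(`TateAlmostEtalePTower`), the package of the PRIME-TO-`p` ("tame") extensions of `K_∞`. This file does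
the ÉTALE case — extensions `L/M` having a power basis with generator a `p`-th power of a unit and
UNIT different `‖f'(θ)‖ = 1`:

* `TateAlmostEtale.exists_norm_repr_eq_of_unit_different` : then the `θ`-coordinates compute norms:
  every `z ∈ L` has a coordinate `λ_i` with `‖λ_i‖ = ‖z‖` (orthogonal basis), so `‖L^×‖ = ‖M^×‖`;
* `TateAlmostEtale.package_of_etale_powerBasis` : **`pkg_s(M) ⇒ pkg_{min s 1}(L)`** ((Γ′) from the
  above, (U′) from `exists_norm_sub_pow_le_of_twisted_powerBasis` with `δ = 0`);
* `TateAlmostEtale.norm_sub_eq_one_of_pow_eq_one` : distinct roots of unity of order prime to `p` are at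
  distance `1`; hence
* `TateAlmostEtale.adjoin_rootOfUnity_package` : **adjoining a root of unity `ζ` of order `N`, `p ∤ N`,
  propagates the package** (`θ = ζ = (ζ^u)^p` with `u p ≡ 1 (mod N)`; `f' (ζ) = Π (ζ - ζ')` is a unit) —
  the unramified-type tame steps of the dévissage.

What remains of the tame part after this file: RAMIFIED prime-to-`p` steps (`ℓ`-th roots of non-units),
which need an almost-orthogonal (not orthonormal) basis. Own elementary route; statement served:
Tate 1967 §3.2 Prop. 9 / Berger–Colmez 2008 Prop. 4.1.1. No `sorry`, no definitions.
-/

noncomputable section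

open Polynomial IntermediateField Module ValuativeRel Field

namespace Literature.NumberTheory.PAdicHodge

namespace TateAlmostEtale

open Literature.NumberTheory.GaloisRepresentations
open Literature.NumberTheory.GaloisRepresentations.IsNonarchimedeanLocalField

variable {F : Type} [Field F] [ValuativeRel F] [TopologicalSpace F] [IsNonarchimedeanLocalField F]
  [CharZero F] {p : ℕ} [Fact p.Prime] (hp : valuation F p < 1)

section Etale

variable (M : IntermediateField (PadicBase F p hp) (NormedAlgClosure F))
  (L : IntermediateField M (NormedAlgClosure F)) [FiniteDimensional M L]

/-- **An étale power basis is orthogonal.** If `pb` is a power basis of `L/M` with `‖pb.gen‖ ≤ 1` and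
unit different `‖f'(pb.gen)‖ = 1` (`f = minpoly`), then every `z ∈ L`, `z ≠ 0`, has a coordinate `λ_i`
with `‖λ_i‖ = ‖z‖`: the coordinates satisfy `‖λ_i‖ ≤ ‖z‖` (`norm_repr_mul_norm_derivative_le`) while
`‖z‖ ≤ max ‖λ_i‖ ‖θ‖^i ≤ max ‖λ_i‖`. [cite: Tate1967, §3.2 Prop. 9] [cite: BergerColmez2008, Prop. 4.1.1] -/
theorem exists_norm_repr_eq_of_unit_different (pb : PowerBasis M L)
    (hgen : ‖(pb.gen : NormedAlgClosure F)‖ ≤ 1)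
    (hH : ‖((aeval pb.gen (derivative (minpoly M pb.gen)) : L) : NormedAlgClosure F)‖ = 1) (z : L) :
    ∃ i : Fin pb.dim, ‖((pb.basis.repr z i : M) : NormedAlgClosure F)‖ = ‖(z : NormedAlgClosure F)‖ := by
  classical
  have hle : ∀ i, ‖((pb.basis.repr z i : M) : NormedAlgClosure F)‖ ≤ ‖(z : NormedAlgClosure F)‖ := by
    intro i
    have h := norm_repr_mul_norm_derivative_le hp M pb hgen z i
    rwa [hH, mul_one] at h
  -- `z = Σ λ_i θ^i`
  have hsum : (z : NormedAlgClosure F) =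
      ∑ i : Fin pb.dim, ((pb.basis.repr z i : M) : NormedAlgClosure F) *
        (pb.gen : NormedAlgClosure F) ^ (i : ℕ) := by
    have h := congrArg (fun y : L => (y : NormedAlgClosure F)) (pb.basis.sum_repr z)
    rw [← h]
    push_cast
    refine Finset.sum_congr rfl fun i _ => ?_
    rw [pb.basis_eq_pow i, Algebra.smul_def, IntermediateField.algebraMap_apply]
    push_cast
    rfl
  have hdim : 0 < pb.dim := pb.dim_pos
  have hne : (Finset.univ : Finset (Fin pb.dim)).Nonempty := ⟨⟨0, hdim⟩, Finset.mem_univ _⟩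
  obtain ⟨i₀, -, hi₀⟩ := IsUltrametricDist.exists_norm_finsetSum_le_of_nonempty hne
    (fun i : Fin pb.dim => ((pb.basis.repr z i : M) : NormedAlgClosure F) *
      (pb.gen : NormedAlgClosure F) ^ (i : ℕ))
  refine ⟨i₀, le_antisymm (hle i₀) ?_⟩
  rw [hsum]
  refine hi₀.trans ?_
  rw [norm_mul, norm_pow]
  exact mul_le_of_le_one_right (norm_nonneg _) (pow_le_one₀ (norm_nonneg _) hgen)

/-- **The package propagates along étale steps.** If `pkg_s(M)` holds and `L/M` has a power basis
generated by `γ^p` for a unit `γ ∈ L` with unit different, then `pkg_{min s 1}(L)`: (Γ′) by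
orthogonality of the basis, (U′) by `exists_norm_sub_pow_le_of_twisted_powerBasis` with `δ = 0`.
[cite: Tate1967, §3.2 Prop. 9] [cite: BergerColmez2008, Prop. 4.1.1] -/
theorem package_of_etale_powerBasis (pb : PowerBasis M L)
    {γ : NormedAlgClosure F} (hγL : γ ∈ L) (hγn : ‖γ‖ = 1)
    (hgen : ((pb.gen : L) : NormedAlgClosure F) = γ ^ p)
    (hH : ‖((aeval pb.gen (derivative (minpoly M pb.gen)) : L) : NormedAlgClosure F)‖ = 1)
    {s : ℝ} (hs : 0 < s)
    (hΓ : ∀ x ∈ M, x ≠ 0 → ∃ c ∈ M, ‖c‖ ^ p = ‖x‖)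
    (hU : ∀ u ∈ M, ‖u‖ ≤ 1 → ∃ w ∈ M, ‖u - w ^ p‖ ≤ ‖(p : NormedAlgClosure F)‖ ^ s) :
    (∀ x ∈ L, x ≠ 0 → ∃ c ∈ L, ‖c‖ ^ p = ‖x‖) ∧
      (∀ u ∈ L, ‖u‖ ≤ 1 → ∃ w ∈ L, ‖u - w ^ p‖ ≤ ‖(p : NormedAlgClosure F)‖ ^ (min s 1)) := by
  have hgen1 : ‖(pb.gen : NormedAlgClosure F)‖ ≤ 1 := by rw [hgen, norm_pow, hγn, one_pow]
  refine ⟨fun x hx hx0 => ?_, fun u hu hu1 => ?_⟩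
  · obtain ⟨i, hi⟩ := exists_norm_repr_eq_of_unit_different hp M L pb hgen1 hH ⟨x, hx⟩
    have hlam0 : ((pb.basis.repr ⟨x, hx⟩ i : M) : NormedAlgClosure F) ≠ 0 := by
      intro h; rw [h, norm_zero] at hi; exact hx0 (norm_eq_zero.mp hi.symm)
    obtain ⟨c, hcM, hc⟩ := hΓ _ (pb.basis.repr ⟨x, hx⟩ i).2 hlam0
    exact ⟨c, IntermediateField.algebraMap_mem L ⟨c, hcM⟩, by rw [hc, hi]⟩
  · have h := exists_norm_sub_pow_le_of_twisted_powerBasis hp M L pb hγL hγn hgen hs le_rfl hΓ hU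
      (by rw [Real.rpow_zero, hH]) hu hu1
    simpa only [sub_zero] using h

end Etale

/-! ### Roots of unity of order prime to `p` -/

section RootsOfUnity

variable (M : IntermediateField (PadicBase F p hp) (NormedAlgClosure F))

include hp in
/-- **Distinct roots of unity of order prime to `p` are at distance `1`**: if `x^N = y^N = 1`, `p ∤ N`,
`x ≠ y`, then `‖x - y‖ = 1` (from `Π_{μ^N = 1, μ ≠ 1} (1 - μ) = N`, a `p`-adic unit, all factors `≤ 1`).
[cite: SerreLocalFields1979, Ch. IV §4] -/
theorem norm_sub_eq_one_of_pow_eq_one {N : ℕ} (hN : ¬ p ∣ N) (hN0 : N ≠ 0) {x y : NormedAlgClosure F}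
    (hx : x ^ N = 1) (hy : y ^ N = 1) (hxy : x ≠ y) : ‖x - y‖ = 1 := by
  classical
  have hprime : p.Prime := Fact.out
  have hx0 : x ≠ 0 := by intro h; rw [h, zero_pow hN0] at hx; exact zero_ne_one hx
  have hxn : ‖x‖ = 1 := by
    have : ‖x‖ ^ N = 1 := by rw [← norm_pow, hx, norm_one]
    exact (pow_eq_one_iff_of_nonneg (norm_nonneg _) hN0).mp this
  -- `ω = y / x ≠ 1`, `ω^N = 1`
  set ω : NormedAlgClosure F := y / x with hω
  have hωN : ω ^ N = 1 := by rw [hω, div_pow, hy, hx, div_one]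
  have hω1 : ω ≠ 1 := by
    intro h; apply hxy; rw [hω, div_eq_one_iff_eq hx0] at h; exact h.symm
  -- the polynomial `X^N - 1`
  set P : (NormedAlgClosure F)[X] := X ^ N - C 1 with hP
  have hmo : P.Monic := monic_X_pow_sub_C 1 hN0
  have hsp : P.Splits := IsAlgClosed.splits P
  have hN0E : (N : NormedAlgClosure F) ≠ 0 := by
    have := norm_natCast_eq_one_of_not_dvd hprime
      (by rw [PadicBase.norm_natCast_closure hp]; exact PadicBase.norm_p_lt_one hp) hN
    intro h; rw [h, norm_zero] at this; exact zero_ne_one this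
  have hroot1 : (1 : NormedAlgClosure F) ∈ P.roots := by
    rw [mem_roots hmo.ne_zero, hP]; simp
  have hrootω : ω ∈ P.roots := by
    rw [mem_roots hmo.ne_zero, hP]; simp [hωN]
  have hsep : P.Separable := by
    rw [hP]; exact separable_X_pow_sub_C 1 hN0E one_ne_zero
  have hnodup : P.roots.Nodup := nodup_roots hsep
  have hder : eval 1 P.derivative = ((P.roots.erase 1).map (1 - ·)).prod := hsp.eval_root_derivative hmo hroot1
  have hder' : eval (1 : NormedAlgClosure F) P.derivative = N := by
    rw [hP, derivative_sub, derivative_X_pow, derivative_C, sub_zero, eval_mul, eval_pow, eval_X, one_pow,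
      mul_one, eval_C]
  have hprod : ‖((P.roots.erase 1).map (1 - ·)).prod‖ = 1 := by
    rw [← hder, hder']
    exact norm_natCast_eq_one_of_not_dvd hprime
      (by rw [PadicBase.norm_natCast_closure hp]; exact PadicBase.norm_p_lt_one hp) hN
  -- the factor `1 - ω` occurs, all factors have norm `≤ 1`
  have hωmem : ω ∈ P.roots.erase 1 := (hnodup.mem_erase_iff).mpr ⟨hω1, hrootω⟩
  have hfacmem : (1 - ω) ∈ (P.roots.erase 1).map (1 - ·) := Multiset.mem_map.mpr ⟨ω, hωmem, rfl⟩
  have hsplit := Multiset.prod_erase hfacmem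
  have hle : ∀ t ∈ ((P.roots.erase 1).map (1 - ·)).erase (1 - ω), ‖t‖ ≤ 1 := by
    intro t ht
    obtain ⟨μ, hμ, rfl⟩ := Multiset.mem_map.mp (Multiset.mem_of_mem_erase ht)
    have hμroot : μ ∈ P.roots := Multiset.mem_of_mem_erase hμ
    rw [mem_roots hmo.ne_zero, hP] at hμroot
    simp only [IsRoot, eval_sub, eval_pow, eval_X, eval_C, sub_eq_zero] at hμroot
    have hμn : ‖μ‖ = 1 := by
      have : ‖μ‖ ^ N = 1 := by rw [← norm_pow, hμroot, norm_one]
      exact (pow_eq_one_iff_of_nonneg (norm_nonneg _) hN0).mp this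
    refine (norm_sub_le_max' _ _).trans ?_
    rw [norm_one, hμn, max_self]
  have hrest : ∀ (m : Multiset (NormedAlgClosure F)), (∀ t ∈ m, ‖t‖ ≤ 1) → ‖m.prod‖ ≤ 1 := by
    intro m hm
    induction m using Multiset.induction_on with
    | empty => simp
    | cons a m ih =>
      rw [Multiset.prod_cons, norm_mul]
      exact mul_le_one₀ (hm a (Multiset.mem_cons_self a m)) (norm_nonneg _)
        (ih fun t ht => hm t (Multiset.mem_cons_of_mem ht))
  have hyn : ‖y‖ = 1 := by
    have : ‖y‖ ^ N = 1 := by rw [← norm_pow, hy, norm_one]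
    exact (pow_eq_one_iff_of_nonneg (norm_nonneg _) hN0).mp this
  have h1 : ‖1 - ω‖ ≤ 1 := by
    have hωn : ‖ω‖ = 1 := by rw [hω, norm_div, hxn, hyn, div_one]
    refine (norm_sub_le_max' _ _).trans ?_
    rw [norm_one, hωn, max_self]
  -- `1 = ‖Π‖ = ‖1 - ω‖ · ‖rest‖ ≤ ‖1 - ω‖`
  have hge : 1 ≤ ‖1 - ω‖ := by
    have := hprod
    rw [← hsplit, norm_mul] at this
    calc (1 : ℝ) = ‖1 - ω‖ * ‖(((P.roots.erase 1).map (1 - ·)).erase (1 - ω)).prod‖ := this.symm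
      _ ≤ ‖1 - ω‖ * 1 := by gcongr; exact hrest _ hle
      _ = ‖1 - ω‖ := mul_one _
  have hω' : ‖1 - ω‖ = 1 := le_antisymm h1 hge
  -- `x - y = x (1 - ω)`
  have : x - y = x * (1 - ω) := by rw [hω, mul_sub, mul_one, mul_div_cancel₀ _ hx0]
  rw [this, norm_mul, hxn, hω', one_mul]

/-- **Adjoining a root of unity of order prime to `p` propagates the package** (the unramified-type
tame steps of the dévissage): if `pkg_s(M)` and `ζ ∈ F̄`, `ζ^N = 1`, `p ∤ N`, then `pkg_{min s 1}(M(ζ))`.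
Indeed `ζ = (ζ^u)^p` for `u p ≡ 1 (mod N)`, the power basis of `M(ζ)` generated by `ζ` consists of
`p`-th powers of units, and its different `f'(ζ) = Π (ζ - ζ')` over the other conjugates (all `N`-th roots
of unity) is a unit (`norm_sub_eq_one_of_pow_eq_one`); conclude by `package_of_etale_powerBasis`.
[cite: Tate1967, §3.2 Prop. 9] [cite: BergerColmez2008, Prop. 4.1.1] -/
theorem adjoin_rootOfUnity_package {N : ℕ} (hN : ¬ p ∣ N) (hN0 : N ≠ 0) {ζ : NormedAlgClosure F}
    (hζ : ζ ^ N = 1) {s : ℝ} (hs : 0 < s)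
    (hΓ : ∀ x ∈ M, x ≠ 0 → ∃ c ∈ M, ‖c‖ ^ p = ‖x‖)
    (hU : ∀ u ∈ M, ‖u‖ ≤ 1 → ∃ w ∈ M, ‖u - w ^ p‖ ≤ ‖(p : NormedAlgClosure F)‖ ^ s) :
    (∀ x ∈ (↥M)⟮ζ⟯, x ≠ 0 → ∃ c ∈ (↥M)⟮ζ⟯, ‖c‖ ^ p = ‖x‖) ∧
      (∀ u ∈ (↥M)⟮ζ⟯, ‖u‖ ≤ 1 → ∃ w ∈ (↥M)⟮ζ⟯, ‖u - w ^ p‖ ≤ ‖(p : NormedAlgClosure F)‖ ^ (min s 1)) := by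
  classical
  have hprime : p.Prime := Fact.out
  have hζn : ‖ζ‖ = 1 := by
    have : ‖ζ‖ ^ N = 1 := by rw [← norm_pow, hζ, norm_one]
    exact (pow_eq_one_iff_of_nonneg (norm_nonneg _) hN0).mp this
  -- `ζ = γ^p` with `γ = ζ^u` a unit of `M(ζ)`
  obtain ⟨u, hu⟩ : ∃ u : ℕ, (ζ ^ u) ^ p = ζ := by
    rcases Nat.lt_or_ge 1 N with h1 | h1
    · have hcop : Nat.Coprime p N := (Nat.Prime.coprime_iff_not_dvd hprime).mpr hN
      obtain ⟨m, -, hm⟩ := Nat.exists_mul_mod_eq_one_of_coprime hcop h1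
      refine ⟨m, ?_⟩
      rw [← pow_mul, mul_comm, ← Nat.div_add_mod (p * m) N, hm, pow_add, pow_mul, hζ, one_pow, one_mul,
        pow_one]
    · have hN1 : N = 1 := by omega
      subst hN1
      rw [pow_one] at hζ
      exact ⟨0, by rw [hζ, pow_zero, one_pow]⟩
  set L : IntermediateField M (NormedAlgClosure F) := (↥M)⟮ζ⟯ with hL
  have hint : IsIntegral M ζ := ⟨X ^ N - C 1, monic_X_pow_sub_C 1 hN0, by simp [hζ]⟩
  haveI : FiniteDimensional M L := adjoin.finiteDimensional hint
  set pb : PowerBasis M L := adjoin.powerBasis hint with hpb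
  have hgen : ((pb.gen : L) : NormedAlgClosure F) = (ζ ^ u) ^ p := by
    rw [hu, hpb, adjoin.powerBasis_gen]; rfl
  have hγL : ζ ^ u ∈ L := pow_mem (mem_adjoin_simple_self _ ζ) u
  have hγn : ‖ζ ^ u‖ = 1 := by rw [norm_pow, hζn, one_pow]
  -- the different of `ζ` is a unit
  have hH : ‖((aeval pb.gen (derivative (minpoly M pb.gen)) : L) : NormedAlgClosure F)‖ = 1 := by
    have hgen' : pb.gen = AdjoinSimple.gen M ζ := by rw [hpb, adjoin.powerBasis_gen]
    rw [hgen']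
    set P' : (NormedAlgClosure F)[X] :=
      (minpoly M (AdjoinSimple.gen M ζ)).map (algebraMap M (NormedAlgClosure F)) with hP'
    have hintg : IsIntegral M (AdjoinSimple.gen M ζ) := .of_finite M _
    have hminζ : minpoly M ζ = minpoly M (AdjoinSimple.gen M ζ) := (minpoly_gen M ζ).symm
    have hsp : P'.Splits := IsAlgClosed.splits P'
    have hmo : P'.Monic := (minpoly.monic hintg).map _
    have hζroot : ζ ∈ P'.roots := by
      rw [mem_roots hmo.ne_zero, IsRoot, hP', eval_map_algebraMap, ← hminζ, minpoly.aeval]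
    have hcoe : ((aeval (AdjoinSimple.gen M ζ) (derivative (minpoly M (AdjoinSimple.gen M ζ))) : L) :
        NormedAlgClosure F) = eval ζ P'.derivative := by
      rw [← IntermediateField.aeval_coe L (AdjoinSimple.gen M ζ), hP', derivative_map, eval_map_algebraMap]
      rfl
    rw [hcoe, hsp.eval_root_derivative hmo hζroot]
    have hsep : P'.Separable := by rw [hP']; exact (minpoly.irreducible hintg).separable.map
    have hnodup : P'.roots.Nodup := nodup_roots hsep
    have hdvd : minpoly M ζ ∣ X ^ N - C 1 := minpoly.dvd M ζ (by simp [hζ])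
    have hfac : ∀ t ∈ (P'.roots.erase ζ).map (ζ - ·), ‖t‖ = 1 := by
      intro t ht
      obtain ⟨r, hr, rfl⟩ := Multiset.mem_map.mp ht
      obtain ⟨hrζ, hr'⟩ := (hnodup.mem_erase_iff).mp hr
      have hrN : r ^ N = 1 := by
        rw [mem_roots hmo.ne_zero, IsRoot, hP', eval_map_algebraMap, ← hminζ] at hr'
        obtain ⟨g, hg⟩ := hdvd
        have : aeval r (X ^ N - C (1 : M)) = 0 := by rw [hg, map_mul, hr', zero_mul]
        simpa [sub_eq_zero] using this
      exact norm_sub_eq_one_of_pow_eq_one hp hN hN0 hζ hrN (Ne.symm hrζ)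
    have hall : ∀ (m : Multiset (NormedAlgClosure F)), (∀ t ∈ m, ‖t‖ = 1) → ‖m.prod‖ = 1 := by
      intro m hm
      induction m using Multiset.induction_on with
      | empty => simp
      | cons a m ih =>
        rw [Multiset.prod_cons, norm_mul, hm a (Multiset.mem_cons_self a m), one_mul]
        exact ih fun t ht => hm t (Multiset.mem_cons_of_mem ht)
    exact hall _ hfac
  exact package_of_etale_powerBasis hp M L pb hγL hγn hgen hH hs hΓ hU

end RootsOfUnity

end TateAlmostEtale

end Literature.NumberTheory.PAdicHodge

end
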